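import Summits.NavierStokesRegularity.NavierStokesRegularity.Theorems.FilamentSkeletonRssDefectColumnGateClosingIVT
import Summits.NavierStokesRegularity.NavierStokesRegularity.Theorems.FilamentSkeletonRssDefectColumnGateDefsR

/-!
# Route `FilamentSkeletonRss` · crux `TransverseReduction1AR` (stmt-NavierStokesRegularity-23611, Variant A1R) · line `defect_column_gate_1AR` —
# `stub_closingIVT1AR : ClosingIVT1AR` (= `DefectContinuity1AG → DefectClosing1AR`), PROVED: the S3a port to the R-crux

Helper file (`--supports stmt-NavierStokesRegularity-23611 --as helper`; LEAD of 23611, lane ns-filament-21221-p1 g12).  VERBATIM the proof of `stub_closingIVT1AL`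
(p665712, lead g11; itself verbatim `stub_closingIVT1AG`, p646026, lead g9) — per-β frozen-rate Picard iteration (`KelvinGate.picard_exists_fixedPoint`), the thresholds
`closing_thresholds`, the intermediate-value theorem on the scalar defect `g − b` given the continuity S3b (`DefectContinuity1AG`, clause-free, p646054), and the
conclusion bookkeeping `almostConcl_of_balanced` — with the clause block `Clauses1L` replaced by `Clauses1R` (the proof reads only `θ₀ ≤ |α|` from the clauses, a
conjunct the 13-J → 13-R swap does not touch).  HONEST FRAMING: MODEL rung, negative side; `TransverseReduction1AR` is neither proved nor refuted; nothing here bears on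
Navier–Stokes regularity.
-/

set_option linter.dupNamespace false

noncomputable section

namespace Summit.NavierStokesRegularity.NavierStokesRegularity.Theorems.DefectColumnGate

open scoped BigOperators Topology InnerProductSpace ContDiff
open Filter Set Function MeasureTheory
open Literature.Analysis.FluidPDE
open Summit.NavierStokesRegularity.NavierStokesRegularity.Theses.FilamentSkeletonRss
open Summit.NavierStokesRegularity.NavierStokesRegularity.Theorems.KelvinGate

/-- **STUB S3a `ClosingIVT1AR` OF LINE `defect_column_gate_1AR`, PROVED** (signature by name): `DefectContinuity1AG → DefectClosing1AR`. -/
theorem stub_closingIVT1AR : ClosingIVT1AR := by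
  intro hcontS N δ ρ K Λ a b cnd η Rw Rb cg θ₀ KA hN hδ hρ ha hη hRw hRb hcg hθ₀ Cs κ C₂ q₀ k₀
  refine ⟨q₀, le_rfl, max (max k₀ 1) (⌈2 * |κ| + |q₀|⌉₊ + 2), le_trans (le_max_left _ _) (le_max_left _ _),
    le_trans (le_max_right _ _) (le_max_left _ _), ?_⟩
  set k : ℕ := max (max k₀ 1) (⌈2 * |κ| + |q₀|⌉₊ + 2) with hk
  intro Cr
  refine ⟨max 1 (64 * C₂ ^ 2 * |Cr| + 4 * |C₂| * |Cr| + 4 * |C₂| * |Cr| / η + 2), ?_⟩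
  intro Γ hΓ γ α X w c m n Aa u v A T hu hv hA hT hcl α0 β₀ U0 P0 Z g r hfam 𝓚 𝓠 𝓫 hgate
  have hΓ1 : 1 ≤ Γ := le_trans (le_max_left _ _) hΓ
  have hΓbig : 64 * C₂ ^ 2 * |Cr| + 4 * |C₂| * |Cr| + 4 * |C₂| * |Cr| / η + 2 ≤ Γ := le_trans (le_max_right _ _) hΓ
  have hΓ0 : 0 < Γ := by linarith
  -- the order `k`
  have hk1 : 1 ≤ k := le_trans (le_max_right _ _) (le_max_left _ _)
  have hkR : 2 * |κ| + |q₀| + 2 ≤ (k:ℝ) := by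
    have h1 : ((⌈2 * |κ| + |q₀|⌉₊ + 2 : ℕ) : ℝ) ≤ (k:ℝ) := by exact_mod_cast le_max_right (max k₀ 1) (⌈2 * |κ| + |q₀|⌉₊ + 2)
    push_cast at h1
    linarith [Nat.le_ceil (2 * |κ| + |q₀|)]
  have hk2κ : 2 * κ + 1 ≤ (k:ℝ) := by linarith [le_abs_self κ, abs_nonneg q₀]
  have hkq : κ - (k:ℝ) + q₀ ≤ -2 := by linarith [le_abs_self κ, le_abs_self q₀, abs_nonneg κ]
  -- family facts
  obtain ⟨hβ₀, hβθ, -, hα0, hgcont, hsign, hmem, -⟩ := id hfam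
  have habs1 : |(-β₀)| ≤ β₀ := by rw [abs_neg, abs_of_pos hβ₀]
  have habs2 : |β₀| ≤ β₀ := by rw [abs_of_pos hβ₀]
  have hres : ∀ β, |β| ≤ β₀ → YBound (r β) (Cr * Γ ^ (-(k:ℝ))) := fun β hβ => (hmem β hβ).2.2.2.2.2.2.2.2.2.2.1
  have hCr : 0 ≤ Cr := by
    have hε0 : 0 ≤ Cr * Γ ^ (-(k:ℝ)) := (hres β₀ habs2).nonneg
    have hpos : 0 < Γ ^ (-(k:ℝ)) := Real.rpow_pos_of_pos hΓ0 _
    by_contra hneg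
    push Not at hneg
    have : Cr * Γ ^ (-(k:ℝ)) < 0 := mul_neg_of_neg_of_pos hneg hpos
    linarith
  obtain ⟨h64, hhalf, hηΓ, hbq⟩ := closing_thresholds hΓ1 hk2κ hk1 hkq hη hCr hΓbig
  set ε : ℝ := Cr * Γ ^ (-(k:ℝ)) with hε
  set Ag : ℝ := C₂ * Γ ^ κ with hAg
  have hε0 : 0 ≤ ε := (hres β₀ habs2).nonneg
  have h16 : 16 * Ag ^ 2 * ε ≤ 1 := by nlinarith [sq_nonneg Ag]
  -- per-β frozen-rate Picard
  have hpic : ∀ β, |β| ≤ β₀ → ∃ F : EuclideanSpace ℝ (Fin 3) → EuclideanSpace ℝ (Fin 3),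
      YBound F (2 * ε) ∧ ∀ y, F y = -r β y - fderiv ℝ (𝓚 β F) y (𝓚 β F y) := by
    intro β hβ
    obtain ⟨hcl1, hcl2⟩ := hgate.1 β hβ
    exact picard_exists_fixedPoint (K := 𝓚 β) (A := Ag) (fun F R hF => (hcl1 F R hF).1)
      (fun F G s hF hG => (hcl2 F G s hF hG).1) (hres β hβ) h16
  choose! G hG using hpic
  -- continuity of the defect coefficient (stub S3b) and its bound
  have hcont : ContinuousOn (fun β => 𝓫 β (G β)) (Icc (-β₀) β₀) :=
    hcontS N Γ ρ η Rw Rb θ₀ k Cs Cr q₀ κ C₂ α X u α0 β₀ U0 P0 Z g r hfam 𝓚 𝓠 𝓫 hgate h64 G hG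
  have hb : ∀ β, |β| ≤ β₀ → |𝓫 β (G β)| < Γ ^ (-q₀) := by
    intro β hβ
    have h := (((hgate.1 β hβ).1) (G β) _ (hG β hβ).1).2.2.2.1
    exact lt_of_le_of_lt h hbq
  -- IVT on `g − b`
  have hββ : -β₀ ≤ β₀ := by linarith
  have hf : ContinuousOn (fun β => g β - 𝓫 β (G β)) (Icc (-β₀) β₀) := hgcont.sub hcont
  obtain ⟨βs, hβs, hzero⟩ : ∃ βs ∈ Icc (-β₀) β₀, g βs - 𝓫 βs (G βs) = 0 := by
    have hb1 := abs_lt.mp (hb (-β₀) habs1)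
    have hb2 := abs_lt.mp (hb β₀ habs2)
    rcases hsign with ⟨h1, h2⟩ | ⟨h1, h2⟩
    · have hlo : g (-β₀) - 𝓫 (-β₀) (G (-β₀)) ≤ 0 := by linarith
      have hhi : 0 ≤ g β₀ - 𝓫 β₀ (G β₀) := by linarith
      obtain ⟨βs, hβs, hval⟩ := intermediate_value_Icc hββ hf ⟨hlo, hhi⟩
      exact ⟨βs, hβs, hval⟩
    · have hlo : g β₀ - 𝓫 β₀ (G β₀) ≤ 0 := by linarith
      have hhi : 0 ≤ g (-β₀) - 𝓫 (-β₀) (G (-β₀)) := by linarith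
      obtain ⟨βs, hβs, hval⟩ := intermediate_value_Icc' hββ hf ⟨hlo, hhi⟩
      exact ⟨βs, hβs, hval⟩
  have hβs' : |βs| ≤ β₀ := abs_le.mpr ⟨hβs.1, hβs.2⟩
  have hbal : g βs = 𝓫 βs (G βs) := sub_eq_zero.mp hzero
  -- the rate `α₁ = α⁰ + β*` is nonzero
  have hα₁ : α0 + βs ≠ 0 := by
    have hθα : θ₀ ≤ |α| := hcl.2.2.2.2.2.2.2.2.2.2.1.1
    intro h0
    have hα0eq : α0 = -βs := eq_neg_of_add_eq_zero_left h0
    have h1 : |α| ≤ |α - α0| + |α0| := by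
      calc |α| = |(α - α0) + α0| := by congr 1; ring
        _ ≤ |α - α0| + |α0| := abs_add_le _ _
    rw [abs_sub_comm] at h1
    rw [hα0eq, abs_neg] at h1
    have h2 : |α0 - α| ≤ θ₀ / 4 := hα0
    rw [hα0eq] at h2
    have h3 : |-βs - α| = |α - -βs| := abs_sub_comm _ _
    linarith [hβs'.trans hβθ]
  obtain ⟨C₀, M, U, P, hconcl⟩ :=
    almostConcl_of_balanced hfam hgate hβs' (hG βs hβs').1 (hG βs hβs').2 hbal hhalf hηΓ hα₁
  exact ⟨α0 + βs, C₀, M, U, P, hconcl⟩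

end Summit.NavierStokesRegularity.NavierStokesRegularity.Theorems.DefectColumnGate

end
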